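import Summits.HodgeConjecture.HodgeConjecture.Theorems.F0P3cStCharTSJacquetSplitTest                  -- ★ T3 «JACQUET SPLIT TEST★»: `normalizedJacquet_mk_eq_smul_iff`, `ker_stable_of_eigenfunctional`, `sub_smul_mem_ker_of_eigenfunctional`; brings ★ `SmoothIndOpenCellHaarFunctional`
import Summits.HodgeConjecture.HodgeConjecture.Theorems.F0P3U3PrincipalSeriesJacquetFiltrationHolds    -- ★ `finrank_le_one_cmPrincipalSeries` (the open-cell part of `r_B i_G(χ)` is at most a line)
import Literature.NumberTheory.Automorphic.CMPrincipalSeriesOpenCellSection                           -- ★ `exists_cmPrincipalSeries_toFun_one_eq_zero_and_integral_cellFun_ne_zero` (the standard open-cell section, `Λ ≠ 0`)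
import Literature.NumberTheory.Automorphic.U3PrincipalSeriesCellFunCompactSupport                     -- ★ G3-CM `hasCompactSupport_cellFun_cmPrincipalSeries_three`
import Literature.NumberTheory.Automorphic.UnitaryGroupUnipotentLimitCompactOpen                      -- ★ `isLimitOfCompactOpen_cmBorelTriple_N`
import Literature.NumberTheory.Automorphic.JacquetNonzeroEmbedsNormalizedInd                          -- ★ `ParabolicTriple.rootDeltaChar_eq_one_of_isLimitOfCompactOpen` (`δ_P^{1/2}|_N = 1`)
import Literature.NumberTheory.Automorphic.LimitCompactOpenUnimodular                                 -- ★ `IsLimitOfCompactOpen.isMulRightInvariant` (`N(L⁺_v)` unimodular)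
import HarnessLib

/-!
# F0 · P3c · line LH6 «StCharTS» — «JACQUET SPLIT TEST @ CM DATUM★» (ROAD «KEYS3-ANALYTIC», brick B6b-DOCK part D1): for `i_G(χ)` on `U(Φ₃)(L⁺_v)`,
# `v` non-split, `m ∈ T` and ANY section `f₀`: **`r_B(m)[f₀] = χ(m)·[f₀]` ⟺ `∫_N (δ_B^{-1/2}(m)·(m·f₀) − χ(m)·f₀)(w₀ n) dn = 0`**
# [BernsteinZelevinsky1977 Prop. 1.9 (a), §2.3, §5 (5.2); Casselman1995 §3.2, §6.3, Lemma 7.1.1 (a); Keys1984 §7]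

Cell `pub/hodgecm-mathlib`, crux H413 = `stmt-HodgeConjecture-24833` (lane `--supports … --as helper`), route HCCMUnconditional; seat F0P2-p01 (g26), DEFAULT §0
on ROAD «KEYS3-ANALYTIC» (holder F0P2-p06 (g21), MEMO `F0/P2/F0P2-p06/g21/MEMO-KEYS3-analytic-road.v3` §1 «B6»; LEAD F0P3a-plan (g16) T15-03).  THEOREMS ONLY
(0 def ∕ 0 instance ∕ 0 notation ∕ 0 sorry); ★-only imports.  Nothing here is specific to the KEYS3 character: the file is the ORGAN GLUE between the algebraic end
★ B6a `F0P3cStCharTSKeys3JacquetSemisimple.secondEigenfunctional_of_one_vector` (hypothesis `hJf₀ : ∀ m, r_B(m)[f₀] = χ(m)·[f₀]`) and the analytic end (★ B5 annulus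
formula ∕ ★ B4 far-out cell function ∕ ★ B3 annulus slice, which evaluate the integral below to `0`).

WHAT.  ★ T3 `F0P3cStCharTSJacquetSplitTest.normalizedJacquet_mk_eq_smul_iff` is the abstract split test «`r_P(m)[f₀] = χ(m)[f₀]` ⟺ `Λ(g₀(m)) = 0`» for ANY `N`-stable
`S ∋ g₀(m)`, `N`-invariant `Λ ≠ 0` on `S` and a line `ℓ ⊇ [S]`.  This file instantiates it ONCE AND FOR ALL at the open cell of a principal series:
* §1 (generic parabolic triple `t = (P, M, N)`, `W = ℂ`, inducing character `χ : M →* ℂˣ`, `ρ = i_P^G χ` = ★ `normalizedInd t (𝟙 ⊗ χ)`): `S = ker ev₁` (`ev₁ f = f(1)` is a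
  `(P, χ δ_P^{1/2})`-eigenfunctional: `toFun_one_normalizedInd_apply`), `Λ f = ∫_N f(w₀ n) dμ(n)` (linear and `N`-invariant for a right-invariant `μ` finite on compacts, ★
  `SmoothInd.integral_cellFun_smoothIndRep`; compact support of the cell functions of `ker ev₁` = hypothesis `hcs`), `ℓ = [ker ev₁]` (at most a line = hypothesis `hfin`), `Λ ≠ 0`
  (= hypothesis `hΦ`, an open-cell section) ⟹ **`normalizedJacquet_mk_eq_smul_iff_integral_cellFun_eq_zero`**: for every `m ∈ M` and EVERY `f₀`,
  `r_P(m)[f₀] = χ(m)·[f₀] ⟺ ∫_N (δ_P^{-1/2}(m)·ρ(m)f₀ − χ(m)·f₀)(w₀ n) dμ(n) = 0`.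
* §2 (`U(Φ₃)(L⁺_v)`, `v` non-split, `χ` continuous, `w₀` of matrix `Φ₃`, `μ` ANY Haar measure of `N(L⁺_v)`): the three hypotheses are ★ (G3-CM `hasCompactSupport_cellFun_cmPrincipalSeries_three`,
  ★ `finrank_le_one_cmPrincipalSeries`, ★ `exists_cmPrincipalSeries_toFun_one_eq_zero_and_integral_cellFun_ne_zero`) ⟹ **`cm_normalizedJacquet_mk_eq_smul_iff_integral_cellFun_eq_zero`**.
* §3 (the pair `χ = (χ₁, χ₂)` = ★ `cmTorusCharPair`): **`pair_normalizedJacquet_mk_eq_smul_iff_integral_cellFun_eq_zero`** — LEFT side = the `hJf₀ m` binder of ★ B6a VERBATIM — and the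
  docking form **`pair_normalizedJacquet_mk_eq_smul_of_forall_integral_eq_zero`**: «all the cell integrals vanish ⟹ `hJf₀`».
USE (B6b-DOCK part D2, not here): with `μ = heisHaar` (★ `isHaarMeasure_heisHaar`), ★ B5 `integral_cellFun_sub_eq_smul_sub_setIntegral` rewrites the integral as `χ(m)·(∫_{c(K)} − ∫_K) F`,
★ B4 + ★ B3 (+ the CM norm dictionary) show it is `0`; then ★ B6a gives `hSecond`, i.e. RUNG 0's `hKeysRed3` in house.
HONEST LABEL: HC_CM is proved only modulo the 7 printed citations (2 remaining named inputs: hLiu418 = `stmt-HodgeConjecture-24832`, h413 = `stmt-HodgeConjecture-24833`) until rung 0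
closes; count-neutral organ glue.

## References
* [BernsteinZelevinsky1977] I. N. Bernstein, A. V. Zelevinsky, *Induced representations of reductive p-adic groups I*, Ann. Sci. ÉNS 10 (1977), Prop. 1.9 (a), §2.3, Geometrical Lemma 2.12, §5 (5.2).
* [Casselman1995] W. Casselman, *Introduction to the theory of admissible representations of p-adic reductive groups* (1995), §3.2 Prop. 3.2.3, §6.3, Lemma 7.1.1 (a).
* [Keys1984] D. Keys, *Principal series representations of special unitary groups over local fields*, Compositio Math. 51 (1984), §7 Thm. (1).
* [Rogawski1990] J. D. Rogawski, *Automorphic Representations of Unitary Groups in Three Variables*, Ann. of Math. Stud. 123 (1990), §12.2 pp. 173–174.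
-/

set_option autoImplicit false
-- the mandated namespace has the single-problem summit's repeated segment (`HodgeConjecture.HodgeConjecture`)
set_option linter.dupNamespace false

noncomputable section

open MeasureTheory
open Literature.NumberTheory.Automorphic Literature.NumberTheory.Automorphic.UnitaryGroup
open Summit.HodgeConjecture.HodgeConjecture.Cruxes.H413.F0P3cStCharTSJacquetSplitTest

namespace Summit.HodgeConjecture.HodgeConjecture.Cruxes.H413.F0P3cStCharTSKeys3SplitTestDatum

/-! ## §1 Generic: the split test at the open cell of `i_P^G χ` -/

section Generic

variable {G : Type*} [Group G] [TopologicalSpace G] [IsTopologicalGroup G]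
  (t : ParabolicTriple G) [LocallyCompactSpace ↥t.P] (χ : ↥t.M →* ℂˣ)

/-- **`ev₁` is a `(P, χ δ_P^{1/2})`-eigenfunctional on `i_P^G χ`**: `(ρ(p) f)(1) = f(1·p) = f(p·1) = χ(proj p) δ_P^{1/2}(p) f(1)` (right translation ★ `toFun_smoothIndRep_apply`,
equivariance ★ `SmoothInd.toFun_subgroup_mul`, ★ `Representation.twist_apply`). [cite: BernsteinZelevinsky1977, §2.3] [cite: Casselman1995, §3.2] -/
theorem toFun_one_normalizedInd_apply (p : ↥t.P)
    (f : Representation.SmoothInd t.P (Representation.twist (((Representation.trivial ℂ ↥t.M ℂ).twist χ).comp t.proj) (rootDeltaChar t.P))) :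
    (Representation.normalizedInd t ((Representation.trivial ℂ ↥t.M ℂ).twist χ) (p : G) f).toFun 1 =
      ((χ (t.proj p) : ℂˣ) : ℂ) * ((rootDeltaChar t.P p : ℂˣ) : ℂ) * f.toFun 1 := by
  have h1 : (Representation.normalizedInd t ((Representation.trivial ℂ ↥t.M ℂ).twist χ) (p : G) f).toFun 1 = f.toFun (1 * (p : G)) := rfl
  have h2 := f.toFun_subgroup_mul p 1
  rw [mul_one] at h2
  rw [h1, one_mul, h2, Representation.twist_apply, MonoidHom.comp_apply, Representation.twist_apply, Representation.trivial_apply,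
    smul_eq_mul, smul_eq_mul]
  ring

variable (w₀ : G) [MeasurableSpace ↥t.N] [BorelSpace ↥t.N] (μ : Measure ↥t.N) [IsFiniteMeasureOnCompacts μ]

/-- **«SPLIT TEST AT THE OPEN CELL» (generic).**  `t = (P, M, N)` a parabolic triple with `N` the union of its compact open subgroups, `ρ = i_P^G χ` (★ `normalizedInd t (𝟙 ⊗ χ)`),
`w₀ ∈ G`, `μ` a right-invariant measure on `N` finite on compacts; assume (`hcs`) every section vanishing at `1` has compactly supported cell function `n ↦ f(w₀ n)`, (`hfin`) the
classes of such sections span at most a line of the Jacquet module, (`hΦ`) one of them has `∫_N Φ(w₀ n) dμ ≠ 0`.  Then for every `m ∈ M` and EVERY section `f₀`: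
**`r_P(m)[f₀] = χ(m)·[f₀]` ⟺ `∫_N (δ_P^{-1/2}(m)·ρ(m) f₀ − χ(m)·f₀)(w₀ n) dμ(n) = 0`** — ★ T3 `normalizedJacquet_mk_eq_smul_iff` at `S = ker ev₁`, `Λ = ∫_N (·)(w₀ n) dμ`, `ℓ = [ker ev₁]`.
[cite: BernsteinZelevinsky1977, Prop. 1.9 (a), §2.3, §5 (5.2)] [cite: Casselman1995, §3.2 Prop. 3.2.3, §6.3, Lemma 7.1.1 (a)] -/
theorem normalizedJacquet_mk_eq_smul_iff_integral_cellFun_eq_zero [μ.IsMulRightInvariant] (hN : IsLimitOfCompactOpen ↥t.N)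
    (hcs : ∀ f : Representation.SmoothInd t.P (Representation.twist (((Representation.trivial ℂ ↥t.M ℂ).twist χ).comp t.proj) (rootDeltaChar t.P)),
      f.toFun 1 = 0 → HasCompactSupport fun n : ↥t.N => f.toFun (w₀ * n))
    (hfin : ∀ ℓ : Submodule ℂ (t.restrict (Representation.normalizedInd t ((Representation.trivial ℂ ↥t.M ℂ).twist χ))).Coinvariants,
      (∀ x, x ∈ ℓ ↔ ∃ f : Representation.SmoothInd t.P (Representation.twist (((Representation.trivial ℂ ↥t.M ℂ).twist χ).comp t.proj) (rootDeltaChar t.P)),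
        f.toFun 1 = 0 ∧ Representation.Coinvariants.mk (t.restrict (Representation.normalizedInd t ((Representation.trivial ℂ ↥t.M ℂ).twist χ))) f = x) →
      FiniteDimensional ℂ ↥ℓ ∧ Module.finrank ℂ ↥ℓ ≤ 1)
    (hΦ : ∃ Φ : Representation.SmoothInd t.P (Representation.twist (((Representation.trivial ℂ ↥t.M ℂ).twist χ).comp t.proj) (rootDeltaChar t.P)),
      Φ.toFun 1 = 0 ∧ ∫ n : ↥t.N, Φ.toFun (w₀ * n) ∂μ ≠ 0)
    (m : ↥t.M) (f₀ : Representation.SmoothInd t.P (Representation.twist (((Representation.trivial ℂ ↥t.M ℂ).twist χ).comp t.proj) (rootDeltaChar t.P))) :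
    (Representation.normalizedInd t ((Representation.trivial ℂ ↥t.M ℂ).twist χ)).normalizedJacquet t m
          (Representation.Coinvariants.mk (t.restrict (Representation.normalizedInd t ((Representation.trivial ℂ ↥t.M ℂ).twist χ))) f₀) =
        ((χ m : ℂˣ) : ℂ) • Representation.Coinvariants.mk (t.restrict (Representation.normalizedInd t ((Representation.trivial ℂ ↥t.M ℂ).twist χ))) f₀ ↔
      ∫ n : ↥t.N, ((((rootDeltaChar t.P (Subgroup.inclusion t.M_le m))⁻¹ : ℂˣ) : ℂ) •
            Representation.normalizedInd t ((Representation.trivial ℂ ↥t.M ℂ).twist χ) (m : G) f₀ - ((χ m : ℂˣ) : ℂ) • f₀).toFun (w₀ * n) ∂μ = 0 := by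
  have hρ : (Representation.normalizedInd t ((Representation.trivial ℂ ↥t.M ℂ).twist χ)).IsSmooth := Representation.isSmooth_smoothInd t.P _
  -- `ev₁` as a linear functional and its eigen-property
  let ev : Representation.SmoothInd t.P (Representation.twist (((Representation.trivial ℂ ↥t.M ℂ).twist χ).comp t.proj) (rootDeltaChar t.P)) →ₗ[ℂ] ℂ :=
    { toFun := fun f => f.toFun 1, map_add' := fun _ _ => rfl, map_smul' := fun _ _ => rfl }
  have hev1 : ∀ f, ev f = f.toFun 1 := fun f => rfl
  have hev : ∀ (p : ↥t.P) (f : Representation.SmoothInd t.P (Representation.twist (((Representation.trivial ℂ ↥t.M ℂ).twist χ).comp t.proj) (rootDeltaChar t.P))),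
      ev (Representation.normalizedInd t ((Representation.trivial ℂ ↥t.M ℂ).twist χ) p f) = ((χ (t.proj p) : ℂˣ) : ℂ) * ((rootDeltaChar t.P p : ℂˣ) : ℂ) * ev f :=
    fun p f => toFun_one_normalizedInd_apply t χ p f
  have hδ : ∀ (n : G) (hn : n ∈ t.N), rootDeltaChar t.P ⟨n, t.N_le hn⟩ = 1 := fun n hn => t.rootDeltaChar_eq_one_of_isLimitOfCompactOpen hN n hn
  -- `S = ker ev₁` is `N`-stable
  have hS := ker_stable_of_eigenfunctional t hδ χ (Representation.normalizedInd t ((Representation.trivial ℂ ↥t.M ℂ).twist χ)) ev hev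
  -- integrability of the cell functions of `ker ev₁`
  have hint : ∀ f : Representation.SmoothInd t.P (Representation.twist (((Representation.trivial ℂ ↥t.M ℂ).twist χ).comp t.proj) (rootDeltaChar t.P)),
      f.toFun 1 = 0 → Integrable (fun n : ↥t.N => f.toFun (w₀ * n)) μ := by
    intro f hf
    have h := SmoothInd.integrable_cellFun t.P (Representation.twist (((Representation.trivial ℂ ↥t.M ℂ).twist χ).comp t.proj) (rootDeltaChar t.P))
      t.N.subtype w₀ μ continuous_subtype_val (f := f) (by simpa only [Subgroup.coe_subtype] using hcs f hf)
    simpa only [Subgroup.coe_subtype] using h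
  -- `Λ f = ∫_N f(w₀ n) dμ` on `ker ev₁`
  let lam : ↥(LinearMap.ker ev) →ₗ[ℂ] ℂ :=
    { toFun := fun f => ∫ n : ↥t.N, f.1.toFun (w₀ * n) ∂μ
      map_add' := fun f g => by
        change ∫ n : ↥t.N, (f.1 + g.1).toFun (w₀ * n) ∂μ = (∫ n : ↥t.N, f.1.toFun (w₀ * n) ∂μ) + ∫ n : ↥t.N, g.1.toFun (w₀ * n) ∂μ
        rw [← integral_add (hint _ (LinearMap.mem_ker.1 f.2)) (hint _ (LinearMap.mem_ker.1 g.2))]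
        rfl
      map_smul' := fun c f => by
        change ∫ n : ↥t.N, (c • f.1).toFun (w₀ * n) ∂μ = c • ∫ n : ↥t.N, f.1.toFun (w₀ * n) ∂μ
        rw [← integral_smul]
        rfl }
  -- `Λ` is `N`-invariant (right invariance of `μ`)
  have hlam : ∀ (n : G) (hn : n ∈ t.N) (f : ↥(LinearMap.ker ev)),
      lam ⟨Representation.normalizedInd t ((Representation.trivial ℂ ↥t.M ℂ).twist χ) n f, hS n hn f.2⟩ = lam f := by
    intro n hn f
    change ∫ n' : ↥t.N, (Representation.smoothIndRep t.P _ (t.N.subtype ⟨n, hn⟩) f.1).toFun (w₀ * n') ∂μ =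
      ∫ n' : ↥t.N, f.1.toFun (w₀ * n') ∂μ
    have h := SmoothInd.integral_cellFun_smoothIndRep t.P (Representation.twist (((Representation.trivial ℂ ↥t.M ℂ).twist χ).comp t.proj) (rootDeltaChar t.P))
      t.N.subtype w₀ μ ⟨n, hn⟩ f.1
    simpa only [Subgroup.coe_subtype] using h
  -- `Λ ≠ 0` (the open-cell section)
  have hlam0 : lam ≠ 0 := by
    obtain ⟨Φ, hΦ1, hΦint⟩ := hΦ
    intro h
    apply hΦint
    have hmem : Φ ∈ LinearMap.ker ev := LinearMap.mem_ker.2 hΦ1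
    have h' := LinearMap.congr_fun h ⟨Φ, hmem⟩
    exact h'
  -- `ℓ = [ker ev₁]`, at most a line
  let ℓ : Submodule ℂ (t.restrict (Representation.normalizedInd t ((Representation.trivial ℂ ↥t.M ℂ).twist χ))).Coinvariants :=
    Submodule.map (Representation.Coinvariants.mk (t.restrict (Representation.normalizedInd t ((Representation.trivial ℂ ↥t.M ℂ).twist χ)))) (LinearMap.ker ev)
  have hℓchar : ∀ x, x ∈ ℓ ↔ ∃ f : Representation.SmoothInd t.P (Representation.twist (((Representation.trivial ℂ ↥t.M ℂ).twist χ).comp t.proj) (rootDeltaChar t.P)),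
      f.toFun 1 = 0 ∧ Representation.Coinvariants.mk (t.restrict (Representation.normalizedInd t ((Representation.trivial ℂ ↥t.M ℂ).twist χ))) f = x := by
    intro x
    simp only [ℓ, Submodule.mem_map, LinearMap.mem_ker, hev1]
  obtain ⟨hfd, h1⟩ := hfin ℓ hℓchar
  haveI := hfd
  have hℓ : ∀ v ∈ LinearMap.ker ev, Representation.Coinvariants.mk (t.restrict (Representation.normalizedInd t ((Representation.trivial ℂ ↥t.M ℂ).twist χ))) v ∈ ℓ :=
    fun v hv => Submodule.mem_map_of_mem hv
  -- ★ T3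
  exact normalizedJacquet_mk_eq_smul_iff t hN _ hρ χ (LinearMap.ker ev) hS lam hlam hlam0 ℓ h1 hℓ m f₀
    (sub_smul_mem_ker_of_eigenfunctional t χ _ ev hev m f₀)

end Generic

/-! ## §2 `U(Φ₃)(L⁺_v)`, `v` non-split: the three hypotheses are ★ -/

section CM

open NumberField IsDedekindDomain

variable (L : Type) [Field L] [NumberField L] [IsCMField L] (v : HeightOneSpectrum (𝓞 ↥(maximalRealSubfield L)))
  (hns : ∀ w : PlacesOver L v, IsCMField.complexConj L • w.1 = w.1)

include hns in
set_option synthInstance.maxHeartbeats 400000 in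
set_option maxHeartbeats 8000000 in
-- statement-heavy: the `SmoothInd` carrier of `cmPrincipalSeries` (class of ★ N1 ∕ ★ B6a)
/-- **«JACQUET SPLIT TEST @ CM DATUM».**  `G = U(Φ₃)(L⁺_v)`, `v` NON-SPLIT, `χ` a continuous character of `T(L⁺_v)`, `w₀ ∈ G` of matrix `Φ₃` (★ `exists_weylElt_three`), `μ` ANY Haar
measure of `N(L⁺_v)` (Borel structure given), `m ∈ T`, `f₀ ∈ i_G(χ)` ANY section: **`r_B(m)[f₀] = χ(m)·[f₀]` ⟺ `∫_N (δ_B^{-1/2}(m)·(m·f₀) − χ(m)·f₀)(w₀ n) dμ(n) = 0`**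
(§1 with ★ G3-CM, ★ `finrank_le_one_cmPrincipalSeries`, ★ the standard open-cell section; `N(L⁺_v)` is unimodular ★, so `μ` is right invariant).
[cite: Casselman1995, Lemma 7.1.1 (a), §6.3] [cite: BernsteinZelevinsky1977, Prop. 1.9 (a), §2.3] [cite: Rogawski1990, §12.2 pp. 173–174] -/
theorem cm_normalizedJacquet_mk_eq_smul_iff_integral_cellFun_eq_zero
    (χ : ↥(torusU (conjLocal L (IsCMField.complexConj L) v) (cmLocalForm L 3 v)) →* ℂˣ) (hχ : Continuous fun x => ((χ x : ℂˣ) : ℂ))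
    (w₀ : ↥(unitaryGroupOfForm (conjLocal L (IsCMField.complexConj L) v) (cmLocalForm L 3 v)))
    (hw₀ : Units.val (w₀ : GL (Fin 3) (LocalRing L v)) = cmLocalForm L 3 v)
    [MeasurableSpace ↥(cmBorelTriple L 3 v).N] [BorelSpace ↥(cmBorelTriple L 3 v).N]
    (μ : Measure ↥(cmBorelTriple L 3 v).N) [μ.IsHaarMeasure]
    (m : ↥(cmBorelTriple L 3 v).M)
    (f₀ : haveI := locallyCompactSpace_cmBorelU L 3 v
      Representation.SmoothInd (cmBorelTriple L 3 v).P
        (Representation.twist (((Representation.trivial ℂ ↥(torusU (conjLocal L (IsCMField.complexConj L) v) (cmLocalForm L 3 v)) ℂ).twist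
          χ).comp (cmBorelTriple L 3 v).proj) (rootDeltaChar (cmBorelTriple L 3 v).P))) :
    haveI := locallyCompactSpace_cmBorelU L 3 v
    (cmPrincipalSeries L 3 v χ).normalizedJacquet (cmBorelTriple L 3 v) m
          (Representation.Coinvariants.mk ((cmBorelTriple L 3 v).restrict (cmPrincipalSeries L 3 v χ)) f₀) =
        ((χ m : ℂˣ) : ℂ) • Representation.Coinvariants.mk ((cmBorelTriple L 3 v).restrict (cmPrincipalSeries L 3 v χ)) f₀ ↔
      ∫ n : ↥(cmBorelTriple L 3 v).N,
          ((((rootDeltaChar (cmBorelTriple L 3 v).P (Subgroup.inclusion (cmBorelTriple L 3 v).M_le m))⁻¹ : ℂˣ) : ℂ) •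
              cmPrincipalSeries L 3 v χ (m : ↥(unitaryGroupOfForm (conjLocal L (IsCMField.complexConj L) v) (cmLocalForm L 3 v))) f₀ -
            ((χ m : ℂˣ) : ℂ) • f₀).toFun
            ((w₀ : ↥(unitaryGroupOfForm (conjLocal L (IsCMField.complexConj L) v) (cmLocalForm L 3 v))) * n) ∂μ = 0 := by
  haveI := locallyCompactSpace_cmBorelU L 3 v
  haveI : LocallyCompactSpace ↥(unitaryGroupOfForm (conjLocal L (IsCMField.complexConj L) v) (cmLocalForm L 3 v)) :=
    locallyCompactSpace_local (IsCMField.complexConj L) 3 _ v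
  have hNcl : IsClosed ((cmBorelTriple L 3 v).N : Set ↥(unitaryGroupOfForm (conjLocal L (IsCMField.complexConj L) v) (cmLocalForm L 3 v))) :=
    (isClosed_upperUnitriangular (n := 3) (R := LocalRing L v)).preimage continuous_subtype_val
  haveI : LocallyCompactSpace ↥(cmBorelTriple L 3 v).N := hNcl.isClosedEmbedding_subtypeVal.locallyCompactSpace
  haveI : SecondCountableTopology ↥(unitaryGroupOfForm (conjLocal L (IsCMField.complexConj L) v) (cmLocalForm L 3 v)) :=
    secondCountableTopology_local (IsCMField.complexConj L) 3 _ v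
  haveI : SecondCountableTopology ↥(cmBorelTriple L 3 v).N := TopologicalSpace.Subtype.secondCountableTopology _
  have hN := isLimitOfCompactOpen_cmBorelTriple_N L 3 v
  haveI : μ.IsMulRightInvariant := hN.isMulRightInvariant μ
  have hcs := hasCompactSupport_cellFun_cmPrincipalSeries_three L v hns χ w₀ hw₀
  have hfin := F0P3U3PrincipalSeriesJacquetFiltrationHolds.finrank_le_one_cmPrincipalSeries L v hns χ
  have hΦ : ∃ Φ : Representation.SmoothInd (cmBorelTriple L 3 v).P
      (Representation.twist (((Representation.trivial ℂ ↥(torusU (conjLocal L (IsCMField.complexConj L) v) (cmLocalForm L 3 v)) ℂ).twist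
        χ).comp (cmBorelTriple L 3 v).proj) (rootDeltaChar (cmBorelTriple L 3 v).P)),
      Φ.toFun 1 = 0 ∧ ∫ n : ↥(cmBorelTriple L 3 v).N,
        Φ.toFun ((w₀ : ↥(unitaryGroupOfForm (conjLocal L (IsCMField.complexConj L) v) (cmLocalForm L 3 v))) * n) ∂μ ≠ 0 := by
    obtain ⟨Φ, hΦ1, -, hΦ3⟩ := exists_cmPrincipalSeries_toFun_one_eq_zero_and_integral_cellFun_ne_zero L 3 v (by norm_num) χ hχ w₀ hw₀ μ
    exact ⟨Φ, hΦ1, hΦ3⟩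
  -- unfold ★ `cmPrincipalSeries` ∕ ★ `principalSeries` to the `normalizedInd` spelling of §1 (definitional, `dsimp`)
  dsimp only [UnitaryGroup.cmPrincipalSeries, UnitaryGroup.principalSeries] at hfin ⊢
  exact normalizedJacquet_mk_eq_smul_iff_integral_cellFun_eq_zero (cmBorelTriple L 3 v) χ _ μ hN hcs hfin hΦ m f₀

end CM

/-! ## §3 The pair `χ = (χ₁, χ₂)`: the `hJf₀` binder of ★ B6a, verbatim -/

section Pair

open NumberField IsDedekindDomain

variable (L : Type) [Field L] [NumberField L] [IsCMField L] (v : HeightOneSpectrum (𝓞 ↥(maximalRealSubfield L)))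
  (hns : ∀ w : PlacesOver L v, IsCMField.complexConj L • w.1 = w.1)

include hns in
set_option synthInstance.maxHeartbeats 400000 in
set_option maxHeartbeats 8000000 in
-- statement-heavy: the `SmoothInd` carrier of `cmPrincipalSeries` (class of ★ N1 ∕ ★ B6a)
/-- **The split test for `i_G(χ₁, χ₂)`** (`χ₁`, `χ₂` continuous; `v` non-split; `w₀` of matrix `Φ₃`; `μ` any Haar measure of `N(L⁺_v)`): for every `m ∈ T` and every section `f₀`,
`r_B(m)[f₀] = χ(m)·[f₀]` — the `hJf₀ m` binder of ★ B6a `secondEigenfunctional_of_one_vector`, VERBATIM — iff the cell integral of `δ_B^{-1/2}(m)·(m·f₀) − χ(m)·f₀` vanishes.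
[cite: Casselman1995, Lemma 7.1.1 (a), §6.3] [cite: Keys1984, §7 Thm. (1)] [cite: Rogawski1990, §12.2 pp. 173–174] -/
theorem pair_normalizedJacquet_mk_eq_smul_iff_integral_cellFun_eq_zero
    (χ₁ : (LocalRing L v)ˣ →* ℂˣ) (χ₂ : ↥(normOneUnits (conjLocal L (IsCMField.complexConj L) v)) →* ℂˣ)
    (h₁ : Continuous fun x => ((χ₁ x : ℂˣ) : ℂ)) (h₂ : Continuous fun x => ((χ₂ x : ℂˣ) : ℂ))
    (w₀ : ↥(unitaryGroupOfForm (conjLocal L (IsCMField.complexConj L) v) (cmLocalForm L 3 v)))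
    (hw₀ : Units.val (w₀ : GL (Fin 3) (LocalRing L v)) = cmLocalForm L 3 v)
    [MeasurableSpace ↥(cmBorelTriple L 3 v).N] [BorelSpace ↥(cmBorelTriple L 3 v).N]
    (μ : Measure ↥(cmBorelTriple L 3 v).N) [μ.IsHaarMeasure]
    (m : ↥(cmBorelTriple L 3 v).M)
    (f₀ : haveI := locallyCompactSpace_cmBorelU L 3 v
      Representation.SmoothInd (cmBorelTriple L 3 v).P
        (Representation.twist (((Representation.trivial ℂ ↥(torusU (conjLocal L (IsCMField.complexConj L) v) (cmLocalForm L 3 v)) ℂ).twist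
          (cmTorusCharPair L v χ₁ χ₂)).comp (cmBorelTriple L 3 v).proj) (rootDeltaChar (cmBorelTriple L 3 v).P))) :
    haveI := locallyCompactSpace_cmBorelU L 3 v
    (cmPrincipalSeries L 3 v (cmTorusCharPair L v χ₁ χ₂)).normalizedJacquet (cmBorelTriple L 3 v) m
          (Representation.Coinvariants.mk ((cmBorelTriple L 3 v).restrict (cmPrincipalSeries L 3 v (cmTorusCharPair L v χ₁ χ₂))) f₀) =
        ((cmTorusCharPair L v χ₁ χ₂ m : ℂˣ) : ℂ) •
          Representation.Coinvariants.mk ((cmBorelTriple L 3 v).restrict (cmPrincipalSeries L 3 v (cmTorusCharPair L v χ₁ χ₂))) f₀ ↔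
      ∫ n : ↥(cmBorelTriple L 3 v).N,
          ((((rootDeltaChar (cmBorelTriple L 3 v).P (Subgroup.inclusion (cmBorelTriple L 3 v).M_le m))⁻¹ : ℂˣ) : ℂ) •
              cmPrincipalSeries L 3 v (cmTorusCharPair L v χ₁ χ₂)
                (m : ↥(unitaryGroupOfForm (conjLocal L (IsCMField.complexConj L) v) (cmLocalForm L 3 v))) f₀ -
            ((cmTorusCharPair L v χ₁ χ₂ m : ℂˣ) : ℂ) • f₀).toFun
            ((w₀ : ↥(unitaryGroupOfForm (conjLocal L (IsCMField.complexConj L) v) (cmLocalForm L 3 v))) * n) ∂μ = 0 :=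
  cm_normalizedJacquet_mk_eq_smul_iff_integral_cellFun_eq_zero L v hns (cmTorusCharPair L v χ₁ χ₂)
    (continuous_cmTorusCharPair_apply L v χ₁ χ₂ h₁ h₂) w₀ hw₀ μ m f₀

include hns in
set_option synthInstance.maxHeartbeats 400000 in
set_option maxHeartbeats 8000000 in
-- statement-heavy: the `SmoothInd` carrier of `cmPrincipalSeries` (class of ★ N1 ∕ ★ B6a)
/-- **DOCKING FORM: «all the cell integrals vanish ⟹ `hJf₀`».**  If, for ONE Haar measure `μ` of `N(L⁺_v)` and the Weyl element `w₀` of matrix `Φ₃`, the cell integral of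
`δ_B^{-1/2}(m)·(m·f₀) − χ(m)·f₀` vanishes for every `m ∈ T`, then `r_B(m)[f₀] = χ(m)·[f₀]` for every `m ∈ T` — the hypothesis `hJf₀` of ★ B6a `secondEigenfunctional_of_one_vector` (with
`f₀(1) = 1` and `wχ = χ` there, this is `hSecond`, i.e. RUNG 0's `hKeysRed3`). [cite: Keys1984, §7 Thm. (1)] [cite: Casselman1995, Lemma 7.1.1 (a)] [cite: Rogawski1990, §12.2 (3) pp. 173–174] -/
theorem pair_normalizedJacquet_mk_eq_smul_of_forall_integral_eq_zero
    (χ₁ : (LocalRing L v)ˣ →* ℂˣ) (χ₂ : ↥(normOneUnits (conjLocal L (IsCMField.complexConj L) v)) →* ℂˣ)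
    (h₁ : Continuous fun x => ((χ₁ x : ℂˣ) : ℂ)) (h₂ : Continuous fun x => ((χ₂ x : ℂˣ) : ℂ))
    (w₀ : ↥(unitaryGroupOfForm (conjLocal L (IsCMField.complexConj L) v) (cmLocalForm L 3 v)))
    (hw₀ : Units.val (w₀ : GL (Fin 3) (LocalRing L v)) = cmLocalForm L 3 v)
    [MeasurableSpace ↥(cmBorelTriple L 3 v).N] [BorelSpace ↥(cmBorelTriple L 3 v).N]
    (μ : Measure ↥(cmBorelTriple L 3 v).N) [μ.IsHaarMeasure]
    (f₀ : haveI := locallyCompactSpace_cmBorelU L 3 v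
      Representation.SmoothInd (cmBorelTriple L 3 v).P
        (Representation.twist (((Representation.trivial ℂ ↥(torusU (conjLocal L (IsCMField.complexConj L) v) (cmLocalForm L 3 v)) ℂ).twist
          (cmTorusCharPair L v χ₁ χ₂)).comp (cmBorelTriple L 3 v).proj) (rootDeltaChar (cmBorelTriple L 3 v).P)))
    (hint : haveI := locallyCompactSpace_cmBorelU L 3 v
      ∀ m : ↥(cmBorelTriple L 3 v).M,
        ∫ n : ↥(cmBorelTriple L 3 v).N,
          ((((rootDeltaChar (cmBorelTriple L 3 v).P (Subgroup.inclusion (cmBorelTriple L 3 v).M_le m))⁻¹ : ℂˣ) : ℂ) •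
              cmPrincipalSeries L 3 v (cmTorusCharPair L v χ₁ χ₂)
                (m : ↥(unitaryGroupOfForm (conjLocal L (IsCMField.complexConj L) v) (cmLocalForm L 3 v))) f₀ -
            ((cmTorusCharPair L v χ₁ χ₂ m : ℂˣ) : ℂ) • f₀).toFun
            ((w₀ : ↥(unitaryGroupOfForm (conjLocal L (IsCMField.complexConj L) v) (cmLocalForm L 3 v))) * n) ∂μ = 0) :
    haveI := locallyCompactSpace_cmBorelU L 3 v
    ∀ m : ↥(cmBorelTriple L 3 v).M,
      (cmPrincipalSeries L 3 v (cmTorusCharPair L v χ₁ χ₂)).normalizedJacquet (cmBorelTriple L 3 v) m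
          (Representation.Coinvariants.mk ((cmBorelTriple L 3 v).restrict (cmPrincipalSeries L 3 v (cmTorusCharPair L v χ₁ χ₂))) f₀) =
        ((cmTorusCharPair L v χ₁ χ₂ m : ℂˣ) : ℂ) •
          Representation.Coinvariants.mk ((cmBorelTriple L 3 v).restrict (cmPrincipalSeries L 3 v (cmTorusCharPair L v χ₁ χ₂))) f₀ :=
  fun m => (pair_normalizedJacquet_mk_eq_smul_iff_integral_cellFun_eq_zero L v hns χ₁ χ₂ h₁ h₂ w₀ hw₀ μ m f₀).2 (hint m)

end Pair

end Summit.HodgeConjecture.HodgeConjecture.Cruxes.H413.F0P3cStCharTSKeys3SplitTestDatum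

end
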